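import Summits.BirchSwinnertonDyer.BirchSwinnertonDyer.Theorems.GenusKolyvaginAtTwoGenusPrimitiveSupplyAtTwoDescentSignShaOverImagQuadratic
import Summits.BirchSwinnertonDyer.BirchSwinnertonDyer.Theorems.GenusKolyvaginAtTwoGenusPrimitiveSupplyAtTwoCorestrictionRealPlace
import Summits.BirchSwinnertonDyer.BirchSwinnertonDyer.Theorems.GenusKolyvaginAtTwoGenusPrimitiveSupplyAtTwoAdmissibleExactDescent
import Literature.NumberTheory.EllipticCurves.SelmerGaloisAction
import Literature.NumberTheory.EllipticCurves.SelmerTorsionRelModelAction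
import Literature.NumberTheory.EllipticCurves.SelmerGroupCardinality
import Summits.BirchSwinnertonDyer.Rank1Residual.F1Sign2.DoorFieldAtTwo
import Summits.BirchSwinnertonDyer.BirchSwinnertonDyer.Theorems.GenusKolyvaginAtTwoGenusPrimitiveSupplyAtTwoArchimedeanRowsHold
import HarnessLib

/-!
# Route `GenusKolyvaginAtTwo`, crux #2 `GenusPrimitiveSupplyAtTwo` (stmt-BirchSwinnertonDyer-22136):
# AN-10K⁼ `F1Sign2.DescentSignIffShaOverAdmissibleField` BY NAME, FINITENESS-FREE —
# on the admissible locus, `ε(E) = −1 ⟺ Ш(E/K)[2] ≠ 0`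

Width seat `bsd-line-gk2-p5` g17 (cell `bsd-f1-sign2`, SUPPLY lineage of crux 22136), file 50 of the series; assembles files 47 (AN-10K `⇒`),
48 (corestriction kills the real place) and 49 (exact descent at admissible `d`). THEOREMS ONLY (no definition, no named fact, no `sorry`,
no local instance); helper `--supports stmt-BirchSwinnertonDyer-22136`; no item is closed; BSD is not proved by any of this.

WHAT. The cell's row AN-10K⁼ (`F1Sign2/DescentSignShaAtTwo.lean`, -an g4; REF1 §24.5 theorem-candidate; REF2 v11: «iff sentence NOT printed;
in-print-assembly Kramer 1981 Thm 1, Thm 2, Props 1–6») is proved BY NAME (`descentSignIffShaOverAdmissibleField_holds`) with NO finiteness of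
`Ш`, no parity and no `L`-function:

* §208 `eq_or_eq_of_natCard_eq_two` (two-element types).
* §209 `torsionH1ToH1_eq_zero_of_mem_selmerGroup_of_shaTwoTrivial` (`Ш(W)[2] = 0 ⟹ Sel₂(W) → Ш(W)` is zero),
  `eq_zero_of_mem_selmerGroup_of_localization_inl_eq_zero_of_meetsEgg` (`ε = +1`, rank one, `E(ℚ)[2] = 0`, `Ш[2] = 0`: the only Selmer class
  trivial at `∞` is `0` — `#Sel₂(W) = 2` and the Kummer class of the egg point is non-trivial at `∞`, file 22),
  **`sha_two_eq_zero_of_meetsEgg_of_descAdmissible`** — `ε(E) = +1 ⟹ Ш(E_K/K)[2] = 0` for `K ∋ √d`, `d` descent-admissible: lift `c` to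
  `m ∈ Sel₂(E_K/K)`; `y = cor m` has `res_K y = m + σ₀m`, `loc_∞ y = 0` (file 48) and `y ∈ Sel₂^{rel ∞}(E) = Sel₂(E)` (file 49 + file 29), so `y = 0`,
  `σ₀m = m`, `m = res_K x₁` (`E(K)[2] = 0`, gk2-p3 `mem_range_resTorsion_iff_conjAct_eq`), `x₁ ∈ Sel₂(E)` (file 49), `c = res_K[x₁] = 0`;
  `resTorsion_mem_selmerGroup_iff_mem_selmerGroupRelaxedAtInfinityAtTwo` — **`res_K⁻¹ Sel₂(E_K/K) = Sel₂^{rel ∞}(E)`** (Kramer Thm. 1, invariant part).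
* §210 **`descentSignIffShaOverAdmissibleField_holds : F1Sign2.DescentSignIffShaOverAdmissibleField`** (`⇒` file 47, `⇐` §209).
* §211 THE `2`-SELMER GROUP OVER THE ADMISSIBLE FIELD: `mordellWeilRank_baseChange_eq_one` (`rank E(K) = 1`),
  `natCard_selmerGroup_baseChange_two_eq_two_mul` (`#Sel₂(E_K/K) = 2·#Ш(E_K/K)[2]`), `natCard_selmerGroup_baseChange_two_eq_two_of_meetsEgg`
  (`ε = +1 ⟹ #Sel₂(E_K/K) = 2`), `four_le_natCard_selmerGroup_baseChange_two_of_not_meetsEgg` (`ε = −1 ⟹ #Sel₂(E_K/K) ≥ 4`), and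
  **`natCard_selmerGroup_baseChange_two_eq_two_iff_meetsEgg`** — on the locus, `#Sel₂(E_K/K) = 2 ⟺ ε(E) = +1` (the hypothesis
  «`Nat.card Sel₂(E/K) = 2`» of the lens's AN-31 `ExponentCapOfMinimalSelmerAtTwo` is the descent sign).
* §212 **`trivialShaDoorFieldSelmerCardAtTwo_holds : F1Sign2.TrivialShaDoorFieldSelmerCardAtTwo`** — -desc's DESC-28-G BY NAME (MEMO-desc §28
  «Ш OVER THE DOOR FIELD», population C; Kramer Thm. 1 with `Φ = 0`): `#Sel₂(W^{(d_K)}) = 1` forces `ε = +1` (T-C `eggTwistLawAtTwo_holds`) and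
  `rank W^{(d_K)} = 0` (descent count), then §211.

Honest framing: Kramer 1981 (Thm. 1 with Prop. 6 `i_∞ = 1`, and the archimedean transfer in place of Thm. 2's pairing) assembled finiteness-free;
kernel-new as an iff; beyond-print theorem: no (in-print-assembly). The census of the row (ε = −1: 4 ∣ #Ш_an(E/ℚ(√−7)) 12/12; ε = +1: #Ш_an(E/K) odd
170/170) is now a theorem on its hypotheses. Crux 22136 stays OPEN exactly at (U) 24947 ∧ (CONV₂) 19220/24948. BSD is not proved by any of this.

References: [Kramer1981] Thm. 1, Thm. 2, §2 Prop. 6; [SerreGaloisCohomology1997] I §2.4, I §2.6 (b); [MilneADT2006] I Prop. 3.8;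
[SilvermanAEC2009] X.§4 (Thm. X.4.2 (a)).
-/

set_option linter.dupNamespace false -- tree convention: `Summit.BirchSwinnertonDyer.BirchSwinnertonDyer.Theorems` (summit = sub-problem)
set_option autoImplicit false

noncomputable section

open scoped Classical

namespace Summit.BirchSwinnertonDyer.BirchSwinnertonDyer.Theorems.GenusKolyArch

open WeierstrassCurve NumberField IsDedekindDomain Field
open Literature.NumberTheory.EllipticCurves Literature.NumberTheory.GaloisRepresentations
open Summit.BirchSwinnertonDyer.Rank1Residual.F1Sign2 (selmerGroupRelaxedAtInfinityAtTwo DescAdmissible NoRationalTwoTorsion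
  ShaTwoTrivial MeetsEgg selmerTwoCard DescentSignIffShaOverAdmissibleField)

/-! ## §208 Two-element groups -/

/-- In a type with exactly two elements, every element is one of two given distinct ones. [folklore] -/
theorem eq_or_eq_of_natCard_eq_two {α : Type*} (h : Nat.card α = 2) {a b : α} (hab : a ≠ b) (c : α) : c = a ∨ c = b := by
  by_contra hc
  rw [not_or] at hc
  haveI : Finite α := Nat.finite_of_card_ne_zero (by rw [h]; decide)
  haveI : Fintype α := Fintype.ofFinite α
  have h3 : Finset.card ({a, b, c} : Finset α) = 3 := by
    rw [Finset.card_insert_of_notMem (by simp [hab, Ne.symm hc.1]),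
      Finset.card_insert_of_notMem (by simp [Ne.symm hc.2]), Finset.card_singleton]
  have := Finset.card_le_univ ({a, b, c} : Finset α)
  rw [h3, ← Nat.card_eq_fintype_card, h] at this
  omega

/-! ## §209 The converse of AN-10K on the admissible locus: `ε(E) = +1 ⟹ Ш(E/K)[2] = 0` -/

section Converse

variable (W : WeierstrassCurve ℚ) [W.IsElliptic] [W.IsGloballyMinimal] (K : Type) [Field K] [NumberField K]

omit [W.IsElliptic] [W.IsGloballyMinimal] in
/-- A `2`-Selmer class of `W` dies in `H¹(ℚ, E)` when `Ш(W)[2] = 0` (its image lies in `Ш(W) ∩ H¹(ℚ, E)[2]`, Silverman X.4.2 (a)).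
[cite: SilvermanAEC2009, Thm X.4.2(a)] -/
theorem torsionH1ToH1_eq_zero_of_mem_selmerGroup_of_shaTwoTrivial (hSha : ShaTwoTrivial W) {x : galH1Torsion W ((2 : ℕ) : ℤ)}
    (hx : x ∈ W.selmerGroup ((2 : ℕ) : ℤ)) : torsionH1ToH1 W ((2 : ℕ) : ℤ) x = 0 := by
  have h2 : ((2 : ℕ) : ℤ) ≠ 0 := by norm_num
  have himg : torsionH1ToH1 W _ x ∈ W.sha ⊓ AddSubgroup.torsionBy W.galH1 ((2 : ℕ) : ℤ) := by
    rw [← WeierstrassCurve.map_torsionH1ToH1_selmerGroup_holds W h2]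
    exact ⟨x, hx, rfl⟩
  exact hSha _ (AddSubgroup.mem_inf.mp himg).1 (AddSubgroup.torsionBy.nsmul_iff.mp (AddSubgroup.mem_inf.mp himg).2)

omit [W.IsGloballyMinimal] in
/-- **A `2`-Selmer class of `W` trivial at `∞` is `0` when `ε(W) = +1`, rank one, `E(ℚ)[2] = 0`, `Ш(W)[2] = 0`**: `#Sel₂(W) = 2`
(`selmerTwoCard_eq_two_of_rank_one`) and the non-trivial class is non-trivial at `∞` (the Kummer class of the egg point, file 22
`exists_mem_selmerGroup_localization_inl_ne_zero_of_meetsEgg`). [cite: Kramer1981, §2 Prop. 6 (p. 127)] -/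
theorem eq_zero_of_mem_selmerGroup_of_localization_inl_eq_zero_of_meetsEgg (hT : NoRationalTwoTorsion W)
    (hrank : W.mordellWeilRank = 1) (hSha : ShaTwoTrivial W) (hegg : MeetsEgg W) {y : galH1Torsion W ((2 : ℕ) : ℤ)}
    (hy : y ∈ W.selmerGroup ((2 : ℕ) : ℤ))
    (hy0 : galoisCohomology.localization (W.torsionGaloisModule ((2 : ℕ) : ℤ)) (Sum.inl Rat.infinitePlace) 1 y = 0) : y = 0 := by
  obtain ⟨x₀, hx₀, hx₀ne⟩ := exists_mem_selmerGroup_localization_inl_ne_zero_of_meetsEgg W hegg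
  have hx₀' : x₀ ∈ W.selmerGroup ((2 : ℕ) : ℤ) :=
    (SetLike.ext_iff.mp (W.selmerGroup_eq_selmerGroup_kummerSelmerStructure _) x₀).mpr hx₀
  have hcard : Nat.card (W.selmerGroup ((2 : ℕ) : ℤ)) = 2 := selmerTwoCard_eq_two_of_rank_one W hT hrank hSha
  have hne : (⟨x₀, hx₀'⟩ : W.selmerGroup ((2 : ℕ) : ℤ)) ≠ 0 := by
    intro h
    have h' : x₀ = 0 := congrArg Subtype.val h
    exact hx₀ne (by rw [h', map_zero])
  rcases eq_or_eq_of_natCard_eq_two hcard hne ⟨y, hy⟩ with h | h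
  · have h' : y = x₀ := congrArg Subtype.val h
    exact absurd (h' ▸ hy0) hx₀ne
  · exact congrArg Subtype.val h

/-- **`ε(E) = +1 ⟹ Ш(E/K)[2] = 0` on the admissible locus — finiteness-free** (the `⇐` of AN-10K⁼). `W/ℚ` globally minimal with `E(ℚ)[2] = 0`,
rank one, `Ш(E)[2] = 0`, `E(ℚ)` meeting the egg; `d` descent-admissible, `K ∋ √d` quadratic. Then every `c ∈ Ш(E_K/K)` with `2c = 0` is `0`.
PROOF. Lift `c` to `m ∈ Sel₂(E_K/K)` (Kummer exactness over `K`); `σ₀ m ∈ Sel₂(E_K/K)` (`K` totally complex); by file 48 there is `y ∈ H¹(ℚ, E[2])`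
with `res_K y = m + σ₀ m` and `loc_∞ y = 0`; by file 49 (exact descent) `y ∈ Sel₂^{rel ∞}(E) = Sel₂(E)` (`ε = +1`), whose only class trivial at `∞`
is `0`; so `σ₀ m = m`, hence (`E(K)[2] = 0`, inflation–restriction) `m = res_K x₁`, again `x₁ ∈ Sel₂(E)`, whose image in `Ш(E)[2] = 0`
vanishes: `c = res_K [x₁] = 0`. No finiteness of `Ш`, no parity, no `L`-function. [cite: Kramer1981, Thm. 1, Thm. 2, Prop. 6]
[cite: SerreGaloisCohomology1997, I §2.4, I §2.6 (b)] -/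
theorem sha_two_eq_zero_of_meetsEgg_of_descAdmissible (hT : NoRationalTwoTorsion W) (hrank : W.mordellWeilRank = 1)
    (hSha : ShaTwoTrivial W) (hegg : MeetsEgg W) {d : ℤ} (hd : DescAdmissible W d) (h2 : Module.finrank ℚ K = 2)
    {i : K} (hi : i ^ 2 = (d : K)) {c : (W.baseChange K).galH1} (hc : c ∈ (W.baseChange K).sha) (h2c : 2 • c = 0) : c = 0 := by
  have hdneg : d < 0 := hd.1
  have h2ne : ((2 : ℕ) : ℤ) ≠ 0 := by norm_num
  haveI : (W.baseChange K).IsElliptic := inferInstanceAs ((W.map (algebraMap ℚ K)).IsElliptic)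
  haveI : IsGalois ℚ K := isGalois_of_finrank_eq_two K h2
  have hK : ∀ w : InfinitePlace K, w.IsComplex := infinitePlace_isComplex_of_sq_eq_intCast hi hdneg
  -- the square-root generator
  have hθ : i ∉ Set.range (algebraMap ℚ K) := by
    rintro ⟨q, hq⟩
    have hq2 : algebraMap ℚ K (q ^ 2) = algebraMap ℚ K (d : ℚ) := by rw [map_pow, hq, hi, map_intCast]
    have hq2' : q ^ 2 = (d : ℚ) := (algebraMap ℚ K).injective hq2
    have hd' : (d : ℚ) < 0 := by exact_mod_cast hdneg
    nlinarith [sq_nonneg q]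
  have hc' : i ^ 2 = algebraMap ℚ K (d : ℚ) := by rw [hi, map_intCast]
  set σ₀ : K ≃ₐ[ℚ] K := sigmaQ K h2 hθ hc' with hσ₀
  have hσ₀1 : σ₀ ≠ 1 := sigmaQ_ne_one K h2 hθ hc'
  -- `E(K)[2] = 0`
  have h2t' : ∀ P : (W.baseChange K).toAffine.Point, ((2 : ℕ) : ℤ) • P = 0 → P = 0 := fun P hP ↦
    Summit.BirchSwinnertonDyer.Rank1Residual.F1Sign2.EggDoubling.eq_zero_of_two_smul_eq_zero_baseChange W hT h2 P
      (by rwa [natCast_zsmul] at hP)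
  -- Step 1: lift `c` to a Selmer class `m`
  have hcmem : c ∈ ((W.baseChange K).selmerGroup ((2 : ℕ) : ℤ)).map (torsionH1ToH1 (W.baseChange K) ((2 : ℕ) : ℤ)) := by
    rw [WeierstrassCurve.map_torsionH1ToH1_selmerGroup_holds (W.baseChange K) h2ne]
    exact AddSubgroup.mem_inf.mpr ⟨hc, AddSubgroup.torsionBy.nsmul_iff.mpr h2c⟩
  obtain ⟨m, hm, hmc⟩ := AddSubgroup.mem_map.mp hcmem
  -- Step 2: `σ₀ m` is Selmer; corestriction
  have hσm : conjAct W σ₀ _ m ∈ (W.baseChange K).selmerGroup ((2 : ℕ) : ℤ) := conjAct_mem_selmerGroup W hK σ₀ _ hm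
  obtain ⟨y, hy, hy0⟩ :=
    exists_resTorsion_eq_add_conjAct_and_localization_inl_eq_zero_of_sq_eq_intCast W K h2 hσ₀1 hi hdneg ((2 : ℕ) : ℤ) m
  -- Step 3: `y ∈ Sel₂^{rel ∞}(W) = Sel₂(W)`, trivial at `∞`, hence `y = 0`
  have hyR : y ∈ selmerGroupRelaxedAtInfinityAtTwo W :=
    mem_selmerGroupRelaxedAtInfinityAtTwo_of_resTorsion_mem_selmerGroup W K hd h2 hi
      (by rw [hy]; exact AddSubgroup.add_mem _ hm hσm)
  rw [selmerGroupRelaxedAtInfinityAtTwo_eq_selmerGroup_of_meetsEgg W hegg] at hyR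
  have hyz : y = 0 := eq_zero_of_mem_selmerGroup_of_localization_inl_eq_zero_of_meetsEgg W hT hrank hSha hegg hyR hy0
  -- Step 4: `m` is `σ₀`-invariant, hence a restriction `res_K x₁`
  have h2m : m + m = 0 := by
    rw [← two_nsmul, ← natCast_zsmul]
    exact zsmul_discreteH1_torsion ((2 : ℕ) : ℤ) m
  have hminv : conjAct W σ₀ ((2 : ℕ) : ℤ) m = m := by
    rw [hyz, map_zero] at hy
    have h1 : conjAct W σ₀ ((2 : ℕ) : ℤ) m = -m := eq_neg_of_add_eq_zero_right hy.symm
    rw [h1, neg_eq_iff_add_eq_zero, h2m]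
  obtain ⟨x₁, hx₁⟩ := (GenusExact.EigenClassesFinite.mem_range_resTorsion_iff_conjAct_eq W K h2 hθ hc' _ h2t' m).mpr hminv
  -- Step 5: `x₁ ∈ Sel₂(W)`, so its image in `Ш(W)[2] = 0` vanishes, and `c = res_K [x₁] = 0`
  have hx₁R : x₁ ∈ selmerGroupRelaxedAtInfinityAtTwo W :=
    mem_selmerGroupRelaxedAtInfinityAtTwo_of_resTorsion_mem_selmerGroup W K hd h2 hi (by rw [hx₁]; exact hm)
  rw [selmerGroupRelaxedAtInfinityAtTwo_eq_selmerGroup_of_meetsEgg W hegg] at hx₁R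
  have hx₁0 := torsionH1ToH1_eq_zero_of_mem_selmerGroup_of_shaTwoTrivial W hSha hx₁R
  rw [← hmc, ← hx₁, torsionH1ToH1_resTorsion, hx₁0, map_zero]

/-- **`res_K⁻¹ Sel₂(E_K/K) = Sel₂^{rel ∞}(W)`** for `K ∋ √d`, `d` descent-admissible: a class of `H¹(ℚ, E[2])` restricts into the `2`-Selmer
group of `E` over `K` iff it satisfies `W`'s Kummer conditions at all FINITE places (file 49 `⇒`; file 47 §200 `⇐`, `K` totally complex).
With `res_K` injective and onto the `Gal(K/ℚ)`-invariants (`E(K)[2] = 0`): `Sel₂(E_K/K)^{Gal(K/ℚ)} ≅ Sel₂^{rel ∞}(W)` (Kramer 1981 Thm. 1,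
invariant part). [cite: Kramer1981, Thm. 1 (proof)] -/
theorem resTorsion_mem_selmerGroup_iff_mem_selmerGroupRelaxedAtInfinityAtTwo {d : ℤ} (hd : DescAdmissible W d)
    (h2 : Module.finrank ℚ K = 2) {i : K} (hi : i ^ 2 = (d : K)) (x : galH1Torsion W ((2 : ℕ) : ℤ)) :
    resTorsion W K ((2 : ℕ) : ℤ) x ∈ (W.baseChange K).selmerGroup ((2 : ℕ) : ℤ) ↔ x ∈ selmerGroupRelaxedAtInfinityAtTwo W := by
  refine ⟨mem_selmerGroupRelaxedAtInfinityAtTwo_of_resTorsion_mem_selmerGroup W K hd h2 hi, fun hx ↦ ?_⟩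
  rw [selmerGroup_eq_comap_sha, AddSubgroup.mem_comap, torsionH1ToH1_resTorsion]
  exact resBaseChange_torsionH1ToH1_mem_sha_of_mem_relaxed W K (infinitePlace_isComplex_of_sq_eq_intCast hi hd.1) hx

/-- **`Sel₂(E_K/K)^{Gal(K/ℚ)} = res_K Sel₂^{rel ∞}(W)`** (Kramer 1981 Thm. 1, the invariant part, finiteness-free): for `W/ℚ` globally minimal with
`E(ℚ)[2] = 0`, `d` descent-admissible, `K ∋ √d` quadratic and ANY non-trivial `σ₀ ∈ Aut(K/ℚ)`, a class `m ∈ H¹(K, E_K[2])` is a `σ₀`-invariant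
`2`-Selmer class of `E_K` iff it is the restriction of a class of the ∞-relaxed `2`-Selmer group of `W` (then of a unique one: `res_K` is injective,
`GenusExact.EigenClassesFinite.resTorsion_injective_of_noTorsion`). [cite: Kramer1981, Thm. 1 (proof)] [cite: GrossLMS1991, §5 (5.1)] -/
theorem mem_selmerGroup_and_conjAct_eq_iff_exists_mem_relaxed (hT : NoRationalTwoTorsion W) {d : ℤ} (hd : DescAdmissible W d)
    (h2 : Module.finrank ℚ K = 2) {i : K} (hi : i ^ 2 = (d : K)) {σ₀ : K ≃ₐ[ℚ] K} (hσ₀ : σ₀ ≠ 1)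
    (m : galH1Torsion (W.baseChange K) ((2 : ℕ) : ℤ)) :
    (m ∈ (W.baseChange K).selmerGroup ((2 : ℕ) : ℤ) ∧ conjAct W σ₀ ((2 : ℕ) : ℤ) m = m) ↔
      ∃ x ∈ selmerGroupRelaxedAtInfinityAtTwo W, resTorsion W K ((2 : ℕ) : ℤ) x = m := by
  haveI : IsGalois ℚ K := isGalois_of_finrank_eq_two K h2
  have hθ : i ∉ Set.range (algebraMap ℚ K) := by
    rintro ⟨q, hq⟩
    have hq2 : algebraMap ℚ K (q ^ 2) = algebraMap ℚ K (d : ℚ) := by rw [map_pow, hq, hi, map_intCast]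
    have hq2' : q ^ 2 = (d : ℚ) := (algebraMap ℚ K).injective hq2
    have hd' : (d : ℚ) < 0 := by exact_mod_cast hd.1
    nlinarith [sq_nonneg q]
  have hc' : i ^ 2 = algebraMap ℚ K (d : ℚ) := by rw [hi, map_intCast]
  have h2t' : ∀ P : (W.baseChange K).toAffine.Point, ((2 : ℕ) : ℤ) • P = 0 → P = 0 := fun P hP ↦
    Summit.BirchSwinnertonDyer.Rank1Residual.F1Sign2.EggDoubling.eq_zero_of_two_smul_eq_zero_baseChange W hT h2 P
      (by rwa [natCast_zsmul] at hP)
  constructor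
  · rintro ⟨hm, hσm⟩
    have hall : ∀ σ : K ≃ₐ[ℚ] K, conjAct W σ ((2 : ℕ) : ℤ) m = m :=
      (RelModel.forall_conjAct_eq_iff_of_finrank_eq_two K W ((2 : ℕ) : ℤ) σ₀ h2 hσ₀ m).mpr hσm
    obtain ⟨x, hx⟩ := (GenusExact.EigenClassesFinite.mem_range_resTorsion_iff_conjAct_eq W K h2 hθ hc' _ h2t' m).mpr (hall _)
    refine ⟨x, mem_selmerGroupRelaxedAtInfinityAtTwo_of_resTorsion_mem_selmerGroup W K hd h2 hi ?_, hx⟩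
    rw [hx]
    exact hm
  · rintro ⟨x, hx, rfl⟩
    exact ⟨(resTorsion_mem_selmerGroup_iff_mem_selmerGroupRelaxedAtInfinityAtTwo W K hd h2 hi x).mpr hx,
      conjAct_resTorsion K W _ σ₀ h2 hσ₀ x⟩

end Converse

/-! ## §210 AN-10K⁼ BY NAME -/

/-- **AN-10K⁼ `F1Sign2.DescentSignIffShaOverAdmissibleField` BY NAME, finiteness-free** (Kramer 1981 Thm. 1 / Thm. 2 / Prop. 6 bookkeeping;
REF1 §24.5, REF2 v11 «iff sentence NOT printed; in-print-assembly»): `Δ > 0`, `E(ℚ)[2] = 0`, rank one, `Ш(E)[2] = 0`, `d` descent-admissible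
with `rank E^{(d)}(ℚ) = 0`, `K ∋ √d` quadratic — `E(ℚ)` misses the egg **iff** `Ш(E/K)` has a non-zero `2`-torsion class. `⇒` is AN-10K
(file 47 `descentSignShaOverImagQuadratic_holds`); `⇐` is §209 (exact descent + corestriction at the real place). BSD is not proved by this.
[cite: Kramer1981, Thm. 1, Thm. 2, Prop. 6] -/
theorem descentSignIffShaOverAdmissibleField_holds : DescentSignIffShaOverAdmissibleField := by
  intro W _ _ hΔ hT hrank hSha d hd hrank0 K _ _ h2 hi
  refine ⟨fun hegg ↦ descentSignShaOverImagQuadratic_holds W ⟨hΔ, hT, hrank, hSha, hegg⟩ d hd.1 hrank0 K h2 hi, ?_⟩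
  rintro ⟨c, hc, hc0, h2c⟩ hegg
  obtain ⟨i, hi⟩ := hi
  exact hc0 (sha_two_eq_zero_of_meetsEgg_of_descAdmissible W K hT hrank hSha hegg hd h2 hi hc h2c)

/-! ## §211 The `2`-Selmer group of `E` over an admissible imaginary quadratic field: `#Sel₂(E_K/K) = 2 ⟺ ε(E) = +1` -/

section SelmerCount

variable (W : WeierstrassCurve ℚ) [W.IsElliptic] [W.IsGloballyMinimal] (K : Type) [Field K] [NumberField K]

omit [W.IsElliptic] [W.IsGloballyMinimal] in
/-- `#E(K)[2] = 1` for `K` quadratic when `E(ℚ)[2] = 0`. [cite: SilvermanAEC2009, Ex. III.3.7 (d)] -/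
theorem natCard_torsionBy_two_baseChange_eq_one (hT : NoRationalTwoTorsion W) (h2 : Module.finrank ℚ K = 2) :
    Nat.card (AddSubgroup.torsionBy (W.baseChange K).toAffine.Point ((2 : ℕ) : ℤ)) = 1 := by
  have hbot : AddSubgroup.torsionBy (W.baseChange K).toAffine.Point ((2 : ℕ) : ℤ) = ⊥ :=
    (AddSubgroup.eq_bot_iff_forall _).mpr fun P hP ↦
      Summit.BirchSwinnertonDyer.Rank1Residual.F1Sign2.EggDoubling.eq_zero_of_two_smul_eq_zero_baseChange W hT h2 P
        (AddSubgroup.torsionBy.nsmul_iff.mp hP)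
  rw [hbot, AddSubgroup.card_bot]

omit [W.IsGloballyMinimal] in
/-- **`rank E(K) = 1`** on the AN-10K⁼ locus (`rank E(ℚ) = 1`, `rank E^{(d)}(ℚ) = 0`, `K ∋ √d`): Silverman Ex. 10.16 (file 47
`mordellWeilRank_baseChange_eq_add_of_sq_eq`). [cite: SilvermanAEC2009, Exercise 10.16] -/
theorem mordellWeilRank_baseChange_eq_one (hrank : W.mordellWeilRank = 1) {d : ℤ} (hd : d < 0)
    (hrank0 : (W.quadraticTwist (d : ℚ)).mordellWeilRank = 0) (h2 : Module.finrank ℚ K = 2) {i : K} (hi : i ^ 2 = (d : K)) :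
    (W.baseChange K).mordellWeilRank = 1 := by
  have hθ : i ∉ Set.range (algebraMap ℚ K) := by
    rintro ⟨q, hq⟩
    have hq2 : algebraMap ℚ K (q ^ 2) = algebraMap ℚ K (d : ℚ) := by rw [map_pow, hq, hi, map_intCast]
    have hq2' : q ^ 2 = (d : ℚ) := (algebraMap ℚ K).injective hq2
    have hd' : (d : ℚ) < 0 := by exact_mod_cast hd
    nlinarith [sq_nonneg q]
  have hc' : i ^ 2 = algebraMap ℚ K (d : ℚ) := by rw [hi, map_intCast]
  rw [mordellWeilRank_baseChange_eq_add_of_sq_eq W K h2 hθ hc', hrank, hrank0]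

omit [W.IsGloballyMinimal] in
/-- **`#Sel₂(E_K/K) = 2 · #Ш(E_K/K)[2]`** when `rank E(K) = 1` and `E(K)[2] = 0` (descent count over `K`, Silverman X.4.2 (a)).
[cite: SilvermanAEC2009, Thm X.4.2(a) and VIII.6] -/
theorem natCard_selmerGroup_baseChange_two_eq_two_mul (hT : NoRationalTwoTorsion W) (h2 : Module.finrank ℚ K = 2)
    (hrk : (W.baseChange K).mordellWeilRank = 1) :
    Nat.card ((W.baseChange K).selmerGroup ((2 : ℕ) : ℤ)) =
      2 * Nat.card ((W.baseChange K).sha ⊓ AddSubgroup.torsionBy (W.baseChange K).galH1 ((2 : ℕ) : ℕ) : AddSubgroup _) := by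
  haveI : (W.baseChange K).IsElliptic := inferInstanceAs ((W.map (algebraMap ℚ K)).IsElliptic)
  have h := card_selmerGroup_eq_pow_rank_mul (W.baseChange K) 2
  rw [natCard_torsionBy_two_baseChange_eq_one W K hT h2, hrk, pow_one, mul_one] at h
  exact h

/-- **`ε(E) = +1 ⟹ #Ш(E_K/K)[2] = 1`** on the admissible locus (§209). [cite: Kramer1981, Thm. 1, Thm. 2, Prop. 6] -/
theorem natCard_sha_inf_torsionBy_two_baseChange_eq_one_of_meetsEgg (hT : NoRationalTwoTorsion W) (hrank : W.mordellWeilRank = 1)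
    (hSha : ShaTwoTrivial W) (hegg : MeetsEgg W) {d : ℤ} (hd : DescAdmissible W d) (h2 : Module.finrank ℚ K = 2)
    {i : K} (hi : i ^ 2 = (d : K)) :
    Nat.card ((W.baseChange K).sha ⊓ AddSubgroup.torsionBy (W.baseChange K).galH1 ((2 : ℕ) : ℕ) : AddSubgroup _) = 1 := by
  have hbot : ((W.baseChange K).sha ⊓ AddSubgroup.torsionBy (W.baseChange K).galH1 ((2 : ℕ) : ℕ) : AddSubgroup _) = ⊥ :=
    (AddSubgroup.eq_bot_iff_forall _).mpr fun c hc ↦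
      sha_two_eq_zero_of_meetsEgg_of_descAdmissible W K hT hrank hSha hegg hd h2 hi (AddSubgroup.mem_inf.mp hc).1
        (AddSubgroup.torsionBy.nsmul_iff.mp (AddSubgroup.mem_inf.mp hc).2)
  rw [hbot, AddSubgroup.card_bot]

/-- **`ε(E) = +1 ⟹ #Sel₂(E_K/K) = 2`** (`= #E(K)/2E(K)`: `Sel₂(E_K/K)` is the Kummer image) on the AN-10K⁼ locus: `E(ℚ)[2] = 0`, rank one,
`Ш(E)[2] = 0`, `E(ℚ)` meets the egg, `d` descent-admissible with `rank E^{(d)}(ℚ) = 0`, `K ∋ √d` quadratic. The hypothesis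
«`Nat.card Sel₂(E/K) = 2`» of the lens's AN-31 holds exactly on `ε = +1`. [cite: Kramer1981, Thm. 1, Prop. 6] -/
theorem natCard_selmerGroup_baseChange_two_eq_two_of_meetsEgg (hT : NoRationalTwoTorsion W) (hrank : W.mordellWeilRank = 1)
    (hSha : ShaTwoTrivial W) (hegg : MeetsEgg W) {d : ℤ} (hd : DescAdmissible W d)
    (hrank0 : (W.quadraticTwist (d : ℚ)).mordellWeilRank = 0) (h2 : Module.finrank ℚ K = 2) {i : K} (hi : i ^ 2 = (d : K)) :
    Nat.card ((W.baseChange K).selmerGroup ((2 : ℕ) : ℤ)) = 2 := by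
  rw [natCard_selmerGroup_baseChange_two_eq_two_mul W K hT h2 (mordellWeilRank_baseChange_eq_one W K hrank hd.1 hrank0 h2 hi),
    natCard_sha_inf_torsionBy_two_baseChange_eq_one_of_meetsEgg W K hT hrank hSha hegg hd h2 hi, mul_one]

/-- **`ε(E) = −1 ⟹ 4 ≤ #Sel₂(E_K/K)`** on the AN-10K⁼ locus (with `Δ > 0`): `Ш(E_K/K)[2] ≠ 0` (AN-10K, file 47), so `#Ш(E_K/K)[2] ≥ 2` and
`#Sel₂(E_K/K) = 2·#Ш(E_K/K)[2] ≥ 4`. [cite: Kramer1981, Thm. 1, Prop. 6] -/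
theorem four_le_natCard_selmerGroup_baseChange_two_of_not_meetsEgg (hΔ : 0 < W.Δ) (hT : NoRationalTwoTorsion W)
    (hrank : W.mordellWeilRank = 1) (hSha : ShaTwoTrivial W) (hegg : ¬ MeetsEgg W) {d : ℤ} (hd : d < 0)
    (hrank0 : (W.quadraticTwist (d : ℚ)).mordellWeilRank = 0) (h2 : Module.finrank ℚ K = 2) {i : K} (hi : i ^ 2 = (d : K)) :
    4 ≤ Nat.card ((W.baseChange K).selmerGroup ((2 : ℕ) : ℤ)) := by
  haveI : (W.baseChange K).IsElliptic := inferInstanceAs ((W.map (algebraMap ℚ K)).IsElliptic)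
  rw [natCard_selmerGroup_baseChange_two_eq_two_mul W K hT h2 (mordellWeilRank_baseChange_eq_one W K hrank hd hrank0 h2 hi)]
  obtain ⟨c, hc, hc0, h2c⟩ := descentSignShaOverImagQuadratic_holds W ⟨hΔ, hT, hrank, hSha, hegg⟩ d hd hrank0 K h2 ⟨i, hi⟩
  set S : AddSubgroup (W.baseChange K).galH1 :=
    (W.baseChange K).sha ⊓ AddSubgroup.torsionBy (W.baseChange K).galH1 ((2 : ℕ) : ℕ) with hS
  haveI : Finite S := by
    have hfin : Finite ((W.baseChange K).selmerGroup ((2 : ℕ) : ℤ)) := finite_selmerGroup_holds (W.baseChange K) (by norm_num)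
    have h := card_selmerGroup_eq_pow_rank_mul (W.baseChange K) 2
    apply Nat.finite_of_card_ne_zero
    intro h0
    rw [h0, mul_zero] at h
    exact (Nat.card_pos (α := (W.baseChange K).selmerGroup ((2 : ℕ) : ℤ))).ne' h
  have hcS : c ∈ S := AddSubgroup.mem_inf.mpr ⟨hc, AddSubgroup.torsionBy.nsmul_iff.mpr h2c⟩
  have h2S : 2 ≤ Nat.card S := by
    have h1 : 1 < Nat.card S := by
      rw [Finite.one_lt_card_iff_nontrivial]
      exact ⟨⟨⟨c, hcS⟩, 0, fun h ↦ hc0 (congrArg Subtype.val h)⟩⟩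
    omega
  omega

/-- **`#Sel₂(E_K/K) = 2 ⟺ ε(E) = +1`** on the AN-10K⁼ locus (`Δ > 0`, `E(ℚ)[2] = 0`, rank one, `Ш(E)[2] = 0`, `d` descent-admissible with
`rank E^{(d)}(ℚ) = 0`, `K ∋ √d` quadratic): the descent sign of `E` IS the size of the `2`-Selmer group over the admissible field.
[cite: Kramer1981, Thm. 1, Thm. 2, Prop. 6] -/
theorem natCard_selmerGroup_baseChange_two_eq_two_iff_meetsEgg (hΔ : 0 < W.Δ) (hT : NoRationalTwoTorsion W)
    (hrank : W.mordellWeilRank = 1) (hSha : ShaTwoTrivial W) {d : ℤ} (hd : DescAdmissible W d)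
    (hrank0 : (W.quadraticTwist (d : ℚ)).mordellWeilRank = 0) (h2 : Module.finrank ℚ K = 2) {i : K} (hi : i ^ 2 = (d : K)) :
    Nat.card ((W.baseChange K).selmerGroup ((2 : ℕ) : ℤ)) = 2 ↔ MeetsEgg W := by
  refine ⟨fun h ↦ ?_, fun hegg ↦ natCard_selmerGroup_baseChange_two_eq_two_of_meetsEgg W K hT hrank hSha hegg hd hrank0 h2 hi⟩
  by_contra hegg
  have h4 := four_le_natCard_selmerGroup_baseChange_two_of_not_meetsEgg W K hΔ hT hrank hSha hegg hd.1 hrank0 h2 hi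
  omega

end SelmerCount


/-! ## §212 DESC-28-G `F1Sign2.TrivialShaDoorFieldSelmerCardAtTwo` BY NAME -/

section DoorField

open Summit.BirchSwinnertonDyer.Rank1Residual.F1Sign2 (shaTwoCard twistSelmerTwoCard IsDoorField fieldSelmerTwoCard
  TrivialShaDoorFieldSelmerCardAtTwo)

/-- `#Ш(W)[2] = 1 ⟹ Ш(W)[2] = 0` (the cell's `shaTwoCard` versus `ShaTwoTrivial`). [folklore] -/
theorem shaTwoTrivial_of_shaTwoCard_eq_one (W : WeierstrassCurve ℚ) (h : shaTwoCard W = 1) : ShaTwoTrivial W := by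
  intro c hc h2c
  have hsub := (Nat.card_eq_one_iff_unique.mp h).1
  have hmem : c ∈ (W.sha ⊓ AddSubgroup.torsionBy W.galH1 (2 : ℕ) : AddSubgroup W.galH1) :=
    AddSubgroup.mem_inf.mpr ⟨hc, AddSubgroup.torsionBy.nsmul_iff.mpr h2c⟩
  exact congrArg Subtype.val (Subsingleton.elim (⟨c, hmem⟩ : (W.sha ⊓ AddSubgroup.torsionBy W.galH1 (2 : ℕ) : AddSubgroup W.galH1))
    ⟨0, AddSubgroup.zero_mem _⟩)

/-- `#Sel₂(W^{(d)}) = 1 ⟹ rank W^{(d)}(ℚ) = 0` (descent count, `d ≠ 0`). [cite: SilvermanAEC2009, Thm X.4.2(a)] -/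
theorem mordellWeilRank_quadraticTwist_eq_zero_of_twistSelmerTwoCard_eq_one (W : WeierstrassCurve ℚ) [W.IsElliptic] {d : ℤ}
    (hd : d ≠ 0) (h : twistSelmerTwoCard W d = 1) : (W.quadraticTwist (d : ℚ)).mordellWeilRank = 0 := by
  haveI : (W.quadraticTwist (d : ℚ)).IsElliptic := W.isElliptic_quadraticTwist (by exact_mod_cast hd)
  haveI : NeZero (2 : ℕ) := ⟨two_ne_zero⟩
  have hc := card_selmerGroup_eq_pow_rank_mul (W.quadraticTwist (d : ℚ)) 2
  change twistSelmerTwoCard W d = _ at hc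
  rw [h, mul_assoc] at hc
  have hdvd : 2 ^ (W.quadraticTwist (d : ℚ)).mordellWeilRank ∣ 1 := Dvd.intro _ hc.symm
  have h1 : 2 ^ (W.quadraticTwist (d : ℚ)).mordellWeilRank = 1 := Nat.eq_one_of_dvd_one hdvd
  by_contra hne
  have hlt : 1 < 2 ^ (W.quadraticTwist (d : ℚ)).mordellWeilRank := Nat.one_lt_two_pow hne
  omega

/-- **DESC-28-G `F1Sign2.TrivialShaDoorFieldSelmerCardAtTwo` BY NAME** (Kramer 1981 Thm. 1 with `Φ = 0`, finiteness-free): `Δ_W > 0`, `E(ℚ)[2] = 0`,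
rank one, `#Ш(W)[2] = 1`, `K` a door field of `W` (`[K : ℚ] = 2`, `d_K` descent-admissible) whose twist `W^{(d_K)}` has `#Sel₂ = 1`: then
`#Sel₂(W/K) = 2`. (`#Sel₂(W^{(d_K)}) = 1` forces `ε(W) = +1` by T-C `eggTwistLawAtTwo_holds` and `rank W^{(d_K)} = 0` by the descent count; then
§211.) The census population C of MEMO-desc §28 is a theorem. [cite: Kramer1981, Thm. 1, Prop. 7, Thm. 2] -/
theorem trivialShaDoorFieldSelmerCardAtTwo_holds : TrivialShaDoorFieldSelmerCardAtTwo := by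
  intro W _ _ hΔ hT hrank hSha1 K _ _ hK htw
  obtain ⟨h2, hd⟩ := hK
  have hSha : ShaTwoTrivial W := shaTwoTrivial_of_shaTwoCard_eq_one W hSha1
  have hegg : MeetsEgg W := by
    by_contra hegg
    have h4 := (eggTwistLawAtTwo_holds W hΔ hT hrank hSha _ hd).2 hegg
    omega
  have hrank0 : (W.quadraticTwist (NumberField.discr K : ℚ)).mordellWeilRank = 0 :=
    mordellWeilRank_quadraticTwist_eq_zero_of_twistSelmerTwoCard_eq_one W hd.1.ne htw
  obtain ⟨i, -, hi⟩ := exists_sq_eq_discr_not_mem_range K h2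
  have hi' : i ^ 2 = ((NumberField.discr K : ℤ) : K) := by rw [hi, map_intCast]
  exact natCard_selmerGroup_baseChange_two_eq_two_of_meetsEgg W K hT hrank hSha hegg hd hrank0 h2 hi'

end DoorField


end Summit.BirchSwinnertonDyer.BirchSwinnertonDyer.Theorems.GenusKolyArch

end
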